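/-
Copyright (c) 2026. All rights reserved.
Released under Apache 2.0 license as described in the file LICENSE.
Authors: abc-iut cell — seat abc-iut-f-107 (F fact-proving wave, tranche 107: FACT-LIST row F-0190; rows F-0189 / F-0191 /
F-0192 are `TPairsSchemaNegative.lean`).
-/
import Mathlib.Logic.Equiv.Bool
import Mathlib.Topology.Instances.ZMod
import Literature.AnabelianGeometry.AbsoluteAnabelian.TPairs
import Literature.AnabelianGeometry.AbsoluteAnabelian.GaloisTheatersTrivialContext
import HarnessLib

/-!
# [AbsTopIII] Cor 5.2 (iv), full faithfulness: the schema `TPairEAHomExtends` (FACT-LIST F-0190) has a REFUTABLE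
# universal closure — the finite-group context and a Klein-four twist

S. Mochizuki, *Topics in absolute anabelian geometry III: global reconstruction algorithms*, J. Math. Sci. Univ.
Tokyo 22 (2015) 939–1156 [MochizukiAbsTopIII2015], Def 5.1 (ii) p. 114, Cor 5.2 (i) p. 119, (iv) pp. 119–120
(manuscript pages).

Negative knowledge recorded next to `TPairs.lean` (abc-iut-L4-t3), PROOF-ONLY (no `def` / `instance` / `structure` /
notation; all witnesses are built inside the proofs), abc-iut cell seat abc-iut-f-107.

`TPairEAHomExtends W hT` (Cor 5.2 (iv), the functor `EA⊚ → Th⊚_T` is full: every morphism `f : Π₁ → Π₂` of `EA⊚`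
extends to a morphism `M⊚_T(Π₁) → M⊚_T(Π₂)` of the canonical global `T`-pairs) is a named `Prop` fact PARAMETRISED by
`R : GlobalAnabelianContext` and `W : TPairVocabulary R T`.  The interface records the canonical global datum
`M_{T⊚}(Π)` and its `Π`-action as free fields `globData`, `globAct` with NO functoriality in `Π` — whereas in print
`M_{T⊚}(Π) = k_NF(Π)` / `k^×_NF(Π)` is "functorially constructed from `Π`" ([AbsTopIII] Thm 1.9 (e)).  This file shows
in the kernel that the universal closure over `(R, W)` is therefore false, at a context where the THEATER-level
statements (Rmk 5.1.1, Cor 5.2 (i), both halves) hold: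

* `GlobalAnabelianContext.exists_finiteGroupContext` — the **FINITE-GROUP context**: `Ob(EA⊚) := {Π ↠ G : Π finite,
  Δ = Π}` (so `G = 1`; for finite `Π` the subgroup `Δ = Π` IS the maximal topologically finitely generated closed
  normal subgroup, so the law `geom_isMax` HOLDS), `k_NF := ℚ` (trivial action), `V⊚(Π) := {⊚}`.  Unlike the
  trivial-group context it has admissible `Π` with OUTER automorphisms.  DEGENERATE (no hyperbolic orbicurve has finite
  `Π_X`); a satisfiability device, nothing about curves.
* `exists_not_tPairEAHomExtends` — over it, for every `T ≠ TLG`, the vocabulary `W` (`T = T⊚ := Type u`, all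
  predicates `⊤`, no local data) whose global datum is `M_{T⊚}(Π) := ULift Bool` with the `Π`-action CHOSEN
  (`Classical.epsilon`) among the actions `ρ` admitting an `EA⊚`-endomorphism `σ` of `Π` with NO `σ`-intertwiner
  `(M, ρ) ≅ (M, ρ ∘ σ)`, whenever such exist (else arbitrary).  At the Klein four-group `Π = (ℤ/2)²` (`G = 1`) they do:
  the character `ρ(a, b) := not^a` and the swap `σ(a, b) := (b, a)` — an intertwiner `φ` would satisfy
  `φ ∘ not = φ`.  Hence `σ` does not extend to `M⊚_T(Π) → M⊚_T(Π)`: `¬ TPairEAHomExtends W`, while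
  `ReferenceIsoUnique R`, `TheaterHomDeterminedByGroupHom R`, `TheaterIsoCanonical R`, `EAHomExtendsToTheaters R` hold
  and `Th⊚_T` is inhabited (the canonical global `T`-pair of `Π`).
* `not_forall_tPairEAHomExtends` — the fully quantified closure is false.

The SATISFIABILITY half (the fact holds at a degenerate vocabulary over the trivial-group context) is abc-iut-w5-d058's
`TPairVocabulary.exists_degenerate_tpairFacts` (`TPairsTrivialContext.lean`); so the row is admissible ONLY in its
instance form at the genuine `(R, W)` (FACT-LIST class «universal-closure REFUTED / schema; instance forms
model-witnessed»).  Refereed pre-IUT anabelian geometry; bookkeeping about the cell's own interface records; nothing of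
[AbsTopIII] is asserted or denied; nothing here bears on the disputed [IUTchIII] Cor. 3.12; refuted-as-typed is never
a fact.
-/

namespace Literature.AnabelianGeometry.AbsoluteAnabelian

open CategoryTheory Topology

universe u

/-- **The FINITE-GROUP context**: `Ob(EA⊚) := {Π ↠ G : Π finite and Δ = Π}` (`IsAdmissible E := Finite Π ∧ Δ = Π`,
stable under isomorphisms of extensions; for such `Π` the law "`Δ` is the maximal topologically finitely generated
closed normal subgroup of `Π`" HOLDS), `k_NF(Π) := ℚ` with the trivial action, `V⊚(Π) := {⊚}` (one point, no local
elements), `V⊚(f) := id`, `k_NF(f) := id`.  DEGENERATE (no hyperbolic orbicurve has finite `Π_X`); it differs from the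
trivial-group context in admitting `Π` with outer automorphisms. [cite: MochizukiAbsTopIII2015, Def 5.1 (ii) p. 114] -/
theorem GlobalAnabelianContext.exists_finiteGroupContext :
    ∃ R : GlobalAnabelianContext.{u}, (∀ E, R.IsAdmissible E ↔ (Finite E.arith ∧ ∀ x, x ∈ E.geom)) ∧
      (∀ E, Subsingleton (R.proVal E).carrier) ∧ (∀ E v, v ∉ (R.proVal E).non) ∧
      (∀ E v, v ∉ (R.proVal E).arc) := by
  let V : ∀ E : FundamentalExtension.{u}, GaloisProSet E.arith := fun E =>
    { carrier := PUnit.{u + 1}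
      continuousSMul := ⟨continuous_const (y := PUnit.unit)⟩
      generic := PUnit.unit
      non := ∅
      arc := ∅
      smul_generic := fun _ => rfl
      generic_notMem_non := fun h => h
      generic_notMem_arc := fun h => h
      disjoint_non_arc := disjoint_bot_left
      eq_generic_or_mem := fun _ => Or.inl rfl
      smul_mem_non := fun _ _ h => h.elim
      smul_mem_arc := fun _ _ h => h.elim }
  have hiso : ∀ {E₁ E₂ : FundamentalExtension.{u}}, Nonempty (E₁ ≅ E₂) →
      (Finite E₁.arith ∧ ∀ x, x ∈ E₁.geom) → (Finite E₂.arith ∧ ∀ x, x ∈ E₂.geom) := by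
    rintro E₁ E₂ ⟨e⟩ ⟨hfin, hgeom⟩
    have hid : ∀ a : E₂.arith, e.hom.arith (e.inv.arith a) = a := fun a => by
      change (e.inv ≫ e.hom).arith a = a
      rw [e.inv_hom_id]; rfl
    haveI := hfin
    exact ⟨Finite.of_surjective e.hom.arith fun a => ⟨e.inv.arith a, hid a⟩,
      fun a => hid a ▸ e.hom.mapsTo_geom (hgeom _)⟩
  have hmax : ∀ E : FundamentalExtension.{u}, (Finite E.arith ∧ ∀ x, x ∈ E.geom) →
      IsMaxTopFGClosedNormal E.geom := by
    rintro E ⟨hfin, hgeom⟩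
    haveI := hfin
    haveI : Fintype E.geom := Fintype.ofFinite _
    exact
      { normal := inferInstance
        isClosed := E.isClosed_geom
        topFG := ⟨Finset.univ, eq_top_iff.mpr fun x _ =>
          Subgroup.le_topologicalClosure _ (by rw [Finset.coe_univ, Subgroup.closure_univ]; trivial)⟩
        maximal := fun N _ _ _ x _ => hgeom x }
  exact
    ⟨{ IsAdmissible := fun E => Finite E.arith ∧ ∀ x, x ∈ E.geom
       isAdmissible_of_iso := hiso
       geom_isMax := hmax
       kNF := fun _ => ULift.{u} ℚ
       instField := fun _ => inferInstance
       instAction := fun E => MulSemiringAction.compHom _ (1 : E.arith →* (ULift.{u} ℚ →+* ULift.{u} ℚ))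
       proVal := V
       archSpace := fun _ v => v.2.elim
       δell := fun _ v => v.2.elim
       κell := fun _ v => v.2.elim
       mapProVal := fun _ _ => Homeomorph.refl _
       mapProVal_smul := fun _ _ _ _ => rfl
       mapKNF := fun _ _ => RingEquiv.refl _ },
      fun _ => Iff.rfl, fun _ => inferInstanceAs (Subsingleton PUnit), fun _ _ h => h, fun _ _ h => h⟩

/-- **F-0190 (Cor 5.2 (iv), full faithfulness `EA⊚ → Th⊚_T`), universal closure false — at a context where Rmk 5.1.1
and Cor 5.2 (i) HOLD.**  Over the finite-group context, for every `T ≠ TLG`: the vocabulary whose global datum is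
`M_{T⊚}(Π) := ULift Bool` with a `Π`-action chosen (`Classical.epsilon`) to admit an `EA⊚`-endomorphism `σ` of `Π`
without `σ`-intertwiner whenever one exists; at the Klein four-group `Π = (ℤ/2)²`, `G = 1` (admissible) the character
`(a, b) ↦ not^a` and the swap `σ` are such, so `σ : Π → Π` does NOT extend to a morphism `M⊚_T(Π) → M⊚_T(Π)` of
global `T`-pairs.  Negative knowledge about the TYPED schema (`globData`/`globAct` carry no functoriality in `Π`);
not a statement about [AbsTopIII]. [cite: MochizukiAbsTopIII2015, Cor 5.2 (iv) p. 120] -/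
theorem exists_not_tPairEAHomExtends (T : TKind) (hT : T ≠ .TLG) :
    ∃ (R : GlobalAnabelianContext.{u}) (W : TPairVocabulary R T), (∃ E, R.IsAdmissible E) ∧
      Nonempty (GlobalTPair W) ∧ ReferenceIsoUnique R ∧ TheaterHomDeterminedByGroupHom R ∧
      TheaterIsoCanonical R ∧ EAHomExtendsToTheaters R ∧ ¬ TPairEAHomExtends W hT := by
  obtain ⟨R, hadm, hs, hnon, harc⟩ := GlobalAnabelianContext.exists_finiteGroupContext.{u}
  -- the vocabulary: `T = T⊚ := Type u`, `M_{T⊚}(Π) := ULift Bool` with an ε-chosen "bad" action when one exists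
  let W : TPairVocabulary R T :=
    { LocObj := Type u
      GlobObj := Type u
      toGlob := 𝟭 (Type u)
      IsContLoc := fun _ => True
      IsContGlob := fun _ => True
      IsMLFGaloisPair := fun _ => True
      KummerStr := fun _ _ => PUnit.{u + 1}
      IsAutHolPair := fun _ => True
      kummerTransport := fun _ _ _ => PUnit.unit
      kummerTransport_refl := fun _ => rfl
      globData := fun _ => ULift.{u} Bool
      globAct := fun E => Classical.epsilon fun ρ : E.arith →* Aut (ULift.{u} Bool) =>
        ∃ σ : E ⟶ E, IsEAHom σ ∧ ∀ φ : ULift.{u} Bool ≅ ULift.{u} Bool, ∃ g : E.arith,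
          (ρ g).hom ≫ φ.hom ≠ φ.hom ≫ (ρ (σ.arith g)).hom
      locDataNon := fun _ _ => PUnit.{u + 1}
      locDataArc := fun _ _ => PUnit.{u + 1}
      locAct := fun _ _ => 1
      locKummer := fun _ _ => PUnit.unit
      locRestrictNon := fun _ _ => TypeCat.ofHom fun _ => PUnit.unit
      locRestrictArc := fun _ _ => TypeCat.ofHom fun _ => PUnit.unit
      cyclotome := fun _ => ProfiniteGrp.of PUnit.{u + 1}
      cyclotomeGrp := fun _ => ProfiniteGrp.of PUnit.{u + 1}
      IsCyclotomeCompatible := fun _ _ => True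
      IsCyclotomeArchCompatible := fun _ _ => True
      ZIndex := PEmpty.{u + 1}
      IsGeomIsoTo := fun z _ => z.elim }
  -- the Klein four-group `Π := (ℤ/2)²` (discrete) with trivial quotient `G := 1`: an object of `EA⊚`
  let K := ULift.{u} (Multiplicative (ZMod 2) × Multiplicative (ZMod 2))
  let E₀ : FundamentalExtension.{u} :=
    { arith := ProfiniteGrp.of K
      gal := ProfiniteGrp.of PUnit.{u + 1}
      aug := ⟨1, continuous_of_discreteTopology⟩
      aug_surjective := fun x => ⟨1, Subsingleton.elim _ _⟩ }
  haveI : DiscreteTopology E₀.arith := inferInstanceAs (DiscreteTopology K)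
  have hgeom : ∀ x : E₀.arith, x ∈ E₀.geom := fun x => show E₀.aug x = 1 from Subsingleton.elim _ _
  have hE₀ : R.IsAdmissible E₀ := (hadm E₀).mpr ⟨inferInstanceAs (Finite K), hgeom⟩
  -- the negation automorphism `n` of `ULift Bool`, the character `ρ(a, b) := n^a`, the swap `σ(a, b) := (b, a)`
  let n : Aut (ULift.{u} Bool) := (Equiv.ulift.trans (Equiv.boolNot.trans Equiv.ulift.symm)).toIso
  have hn : n * n = 1 :=
    Aut.ext (ConcreteCategory.hom_ext _ _ fun x => by obtain ⟨b⟩ := x; cases b <;> rfl)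
  have h1 : (1 : ZMod 2) ≠ 0 := by decide
  have h01 : (0 : ZMod 2) + 1 ≠ 0 := by decide
  have h11 : (1 : ZMod 2) + 1 = 0 := by decide
  have hsplit : ∀ a : ZMod 2, a = 0 ∨ a = 1 := by decide
  let ρ : E₀.arith →* Aut (ULift.{u} Bool) :=
    MonoidHom.mk' (fun g => if Multiplicative.toAdd (ULift.down g).1 = 0 then 1 else n) fun g h => by
      change (if Multiplicative.toAdd (ULift.down g).1 + Multiplicative.toAdd (ULift.down h).1 = 0 then 1 else n) =
        (if Multiplicative.toAdd (ULift.down g).1 = 0 then 1 else n) *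
          (if Multiplicative.toAdd (ULift.down h).1 = 0 then 1 else n)
      rcases hsplit (Multiplicative.toAdd (ULift.down g).1) with hg | hg <;>
        rcases hsplit (Multiplicative.toAdd (ULift.down h).1) with hh | hh <;>
          simp only [hg, hh, add_zero, h01, h11, h1, if_true, if_false, one_mul, mul_one, hn]
  let e : K ≃* K := MulEquiv.ulift.trans (MulEquiv.prodComm.trans MulEquiv.ulift.symm)
  let σ : E₀ ⟶ E₀ :=
    { arith := ⟨e.toMonoidHom, continuous_of_discreteTopology⟩
      gal := ContinuousMonoidHom.id _
      comm := fun _ => rfl }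
  have hσ : IsEAHom σ :=
    { bijOn_geom := ⟨fun x _ => hgeom _, e.injective.injOn, fun y _ => ⟨e.symm y, hgeom _, e.apply_symm_apply y⟩⟩
      injective := e.injective
      isOpen_range := isOpen_discrete _ }
  -- `(ULift Bool, ρ)` admits no `σ`-intertwiner: test `g := (1, 0)` (`ρ g = n`, `ρ (σ g) = 1`) at `true`
  have hBad : ∃ ρ : E₀.arith →* Aut (ULift.{u} Bool), ∃ σ : E₀ ⟶ E₀, IsEAHom σ ∧
      ∀ φ : ULift.{u} Bool ≅ ULift.{u} Bool, ∃ g : E₀.arith, (ρ g).hom ≫ φ.hom ≠ φ.hom ≫ (ρ (σ.arith g)).hom := by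
    refine ⟨ρ, σ, hσ, fun φ => ⟨ULift.up (Multiplicative.ofAdd 1, Multiplicative.ofAdd 0), fun heq => ?_⟩⟩
    have hu : ρ (ULift.up (Multiplicative.ofAdd 1, Multiplicative.ofAdd 0)) = n :=
      show (if (1 : ZMod 2) = 0 then (1 : Aut (ULift.{u} Bool)) else n) = n from if_neg h1
    have hv : ρ (σ.arith (ULift.up (Multiplicative.ofAdd 1, Multiplicative.ofAdd 0))) = 1 :=
      show (if (0 : ZMod 2) = 0 then (1 : Aut (ULift.{u} Bool)) else n) = 1 from if_pos rfl
    rw [hu, hv] at heq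
    have h₁ : (n.hom ≫ φ.hom) (ULift.up true) = φ.hom (ULift.up false) := rfl
    have h₂ : (φ.hom ≫ (1 : Aut (ULift.{u} Bool)).hom) (ULift.up true) = φ.hom (ULift.up true) := rfl
    have hinj : Function.Injective φ.hom := φ.toEquiv.injective
    have : φ.hom (ULift.up false) = φ.hom (ULift.up true) := by rw [← h₁, ← h₂, heq]
    exact absurd (hinj this) (by simp)
  -- hence the ε-chosen canonical action at `Π = (ℤ/2)²` is bad for some `EA⊚`-endomorphism `σ₀`
  obtain ⟨σ₀, hσ₀, hbad⟩ := Classical.epsilon_spec hBad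
  refine ⟨R, W, ⟨E₀, hE₀⟩, ⟨W.canonical E₀ hE₀ trivial (fun _ => trivial) (fun _ => trivial)⟩,
    referenceIsoUnique_of_subsingleton R hs, theaterHomDeterminedByGroupHom_of_subsingleton R hs,
    theaterIsoCanonical_of_forall_notMem_arc R harc, eaHomExtendsToTheaters_of_subsingleton R hs hnon harc,
    fun h => ?_⟩
  obtain ⟨φ, hφ⟩ := h E₀ E₀ hE₀ hE₀ trivial (fun _ => trivial) (fun _ => trivial) trivial (fun _ => trivial)
    (fun _ => trivial) σ₀ hσ₀
  obtain ⟨g, hg⟩ := hbad φ.φM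
  have := φ.φM_equivariant g
  rw [hφ] at this
  exact hg this

/-- **F-0190: the universal closure of `TPairEAHomExtends` is FALSE.** [cite: MochizukiAbsTopIII2015, Cor 5.2 (iv) p. 120] -/
theorem not_forall_tPairEAHomExtends :
    ¬ ∀ (R : GlobalAnabelianContext.{u}) (T : TKind) (W : TPairVocabulary R T) (hT : T ≠ .TLG),
      Literature.AnabelianGeometry.AbsoluteAnabelian.TPairEAHomExtends W hT := by
  intro h
  obtain ⟨R, W, -, -, -, -, -, -, hW⟩ := exists_not_tPairEAHomExtends.{u} .TF (by decide)
  exact hW (h R _ W _)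

end Literature.AnabelianGeometry.AbsoluteAnabelian
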